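import Mathlib
import HarnessLib.Audit
import Summits.PneNP.PneNP.Theorems.PstarNorUnitAssembly
import Summits.PneNP.PneNP.Theorems.PstarNorUnitDir

/-!
# All chords NOR-forced in a read direction ⟹ at most five outputs (ROUND-24, memo §9 R8 → R9; `q_m` version)

FRONTIER range-avoidance ladder, rung F-N3, ROUND 24 (cell `pnp-ideate`, planner memo `r24/CORE-BOUND-NOTES.md` §9 R5–R9; restricted-model proof
complexity — nothing here bears on `P` versus `NP`).

`PstarNorUnitAssembly.card_le_five_of_all_nor` with the NOR data taken with respect to the basis-changed constraint `q_m`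
(`PstarChordBridgeBasis.qDir / polarDir`), i.e. in the shape returned for every chord by the second disjunct of
`PstarChordBridgeBasis.regime_cases` (pnp-ideate-prover-2) when no chord is (EQ) or (EXC): `card_le_five_of_all_nor_dir` — bridge data WF,
`#J₀ < r`, `#(J₀ ∪ G₁ ∪ G₂) ≤ r`, pendants off the core, a chord, and the NOR disjunct for every chord ⟹ the chords together with their
fundamental sets number at most five (`card_units_le_five_dir` — that sub-family is XOR-closed by itself, `xorClosed_units`), hence `#J₀ ≤ 5`
when the fundamental sets cover the non-chords (per chord `PstarNorUnitDir.nor_unit_of_dir`; common pair by `lit_iff_of_dir`; gadget outside `J₀`;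
`PstarNorUnitAssembly.litAdj_path`; `PstarLitNorCore.LitNorStructure`; `litNorCoreBound`).
-/

set_option linter.dupNamespace false -- `Summit.PneNP.PneNP.…`: summit = sub-problem name (D-0017 single-conjunct layout)

open Finset Module Literature.Computability.Complexity
open Summit.PneNP.PneNP.Theorems.PstarSALevel (varSet bdry BoundaryExpanding SimpleOverlap)
open Summit.PneNP.PneNP.Theorems.PstarGapLinearised (andPair andPair_subset_varSet)
open Summit.PneNP.PneNP.Theorems.PstarChordEndgameTools (mem_andPair_iff)
open Summit.PneNP.PneNP.Theorems.PstarXCore (xpair mem_xpair)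
open Summit.PneNP.PneNP.Theorems.PstarChordRepair (IsChord)
open Summit.PneNP.PneNP.Theorems.PstarCoreBound (XorClosed)
open Summit.PneNP.PneNP.Theorems.PstarCubeIdeals (IsAffineFn)
open Summit.PneNP.PneNP.Theorems.PstarProductRank (qform)
open Summit.PneNP.PneNP.Theorems.PstarLitNorCore (LitEdge LitAdj LitNorStructure)
open Summit.PneNP.PneNP.Theorems.PstarLitNorCoreProof (litNorCoreBound)
open Summit.PneNP.PneNP.Theorems.PstarChordBridgeTools (xpdeg)
open Summit.PneNP.PneNP.Theorems.PstarChordBridge (BridgeData sys)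
open Summit.PneNP.PneNP.Theorems.PstarChordBridgeFundamental (xpdeg_insert odd_of_end exists_mem_of_odd false_of_both_ends)
open Summit.PneNP.PneNP.Theorems.PstarChordBridgeForcing (freeMon freePolar gam rank_four_of_wf)
open Summit.PneNP.PneNP.Theorems.PstarForcing (not_rank_four_of_mul)
open Summit.PneNP.PneNP.Theorems.PstarReadSumset (V2)
open Summit.PneNP.PneNP.Theorems.PstarChordBridgeBasis (qDir polarDir)
open Summit.PneNP.PneNP.Theorems.PstarNorUnitAssembly (litAdj_path)
open Summit.PneNP.PneNP.Theorems.PstarNorUnitDir (nor_unit_of_dir lit_iff_of_dir)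
open Summit.PneNP.PneNP.Theorems.PstarNorUnitBridge (xor_not_mem_bdry_of_even)
open Summit.PneNP.PneNP.Theorems.PstarCentreFree (vars_mem_varSet)

namespace Summit.PneNP.PneNP.Theorems.PstarNorUnitDirAssembly

variable {n m : ℕ}

/-! ## Boundary bookkeeping for sub-families -/

/-- A boundary variable of `J` read by a member of `J' ⊆ J` is a boundary variable of `J'`. -/
theorem mem_bdry_of_subset (I : LocalMap 4 n m) {J J' : Finset (Fin m)} (hJ : J' ⊆ J) {j : Fin m} (hj : j ∈ J') {v : Fin n}
    (hv : v ∈ varSet I j) (hb : v ∈ bdry I J) : v ∈ bdry I J' := by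
  classical
  unfold PstarSALevel.bdry at hb ⊢
  rw [mem_filter] at hb ⊢
  refine ⟨mem_univ _, le_antisymm ?_ (card_pos.2 ⟨j, mem_filter.2 ⟨hj, hv⟩⟩)⟩
  rw [← hb.2]
  exact card_le_card (filter_subset_filter _ hJ)

/-- `IsChord` descends to sub-families containing the chord. -/
theorem isChord_of_subset (I : LocalMap 4 n m) {J J' : Finset (Fin m)} (hJ : J' ⊆ J) {e : Fin m} (he : e ∈ J') (h : IsChord I J e) :
    IsChord I J' e :=
  ⟨mem_bdry_of_subset I hJ he (vars_mem_varSet I e 2) h.1, mem_bdry_of_subset I hJ he (vars_mem_varSet I e 3) h.2⟩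

/-- **The union of the chords and their fundamental sets is XOR-closed** (each `D e + e` is everywhere even). -/
theorem xorClosed_units (I : LocalMap 4 n m) (hI : I.IsPure xorAndPred) {B : BridgeData n m} (hW : B.WF I) :
    XorClosed I (B.N ∪ B.N.biUnion B.D) := by
  classical
  intro j hj s hs hb
  -- `j` lies in some `D e + e`
  obtain ⟨e, he, hje⟩ : ∃ e ∈ B.N, j ∈ insert e (B.D e) := by
    rcases mem_union.1 hj with h | h
    · exact ⟨j, h, mem_insert_self _ _⟩
    · obtain ⟨e, he, hjD⟩ := mem_biUnion.1 h
      exact ⟨e, he, mem_insert_of_mem hjD⟩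
  have hsub : insert e (B.D e) ⊆ B.N ∪ B.N.biUnion B.D := by
    intro i hi
    rcases mem_insert.1 hi with rfl | hi
    · exact mem_union_left _ he
    · exact mem_union_right _ (mem_biUnion.2 ⟨e, he, hi⟩)
  exact xor_not_mem_bdry_of_even I hI (hW.hDeven e he) j hje s hs (mem_bdry_of_subset I hsub hje (vars_mem_varSet I j s) hb)

/-! ## The assembly -/

/-- **All chords NOR-forced ⟹ the chords and their fundamental sets number at most five.**  No covering hypothesis: the
sub-family `N ∪ ⋃ₑ D e` is itself XOR-closed (`xorClosed_units`) and carries the whole `LitNorStructure`. -/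
theorem card_units_le_five_dir (I : LocalMap 4 n m) (hI : I.IsPure xorAndPred) (hS : SimpleOverlap I) {r : ℕ}
    (hB : BoundaryExpanding r I) {B : BridgeData n m} (hW : B.WF I) (hr : (B.J₀ ∪ B.G₁ ∪ B.G₂).card ≤ r) (hJr : B.J₀.card < r)
    (hG₁ : Disjoint B.G₁ B.J₀) (hG₂ : Disjoint B.G₂ B.J₀) (hN : B.N.Nonempty) (mv : V2)
    (hNOR : ∀ e ∈ B.N, ∃ a b : Fin n → ZMod 2, ∃ β α : ZMod 2, ∃ m₁ m₂ : (Fin n → ZMod 2) → ZMod 2,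
      polarDir I B mv a b = 1 ∧
      (∀ x, qDir I B mv x = (polarDir I B mv x b + β) * (polarDir I B mv x a + α) + 1) ∧
      IsAffineFn m₁ ∧ IsAffineFn m₂ ∧
      ∀ x, qform (B.D e) (fun j => I.vars j 2) (fun j => I.vars j 3) x + (gam B e + 1) =
        (polarDir I B mv x b + β + 1) * m₁ x + (polarDir I B mv x a + α + 1) * m₂ x) :
    (B.N ∪ B.N.biUnion B.D).card ≤ 5 := by
  classical
  set J' : Finset (Fin m) := B.N ∪ B.N.biUnion B.D with hJ'
  have hJ'sub : J' ⊆ B.J₀ := by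
    intro j hj
    rcases mem_union.1 hj with h | h
    · exact hW.hN h
    · obtain ⟨e, he, hjD⟩ := mem_biUnion.1 h
      exact (mem_sdiff.1 (hW.hD e he hjD)).1
  have hDJ' : ∀ {e}, e ∈ B.N → ∀ {j}, j ∈ B.D e → j ∈ J' := fun he _ hj => mem_union_right _ (mem_biUnion.2 ⟨_, he, hj⟩)
  -- shift-sensitivity: the chord-independent literal predicate
  set Lit : Fin n → Prop := fun v => ∃ x, qDir I B mv (x + Pi.single v 1) ≠ qDir I B mv x with hLit
  have heG : ∀ e ∈ B.N, e ∉ B.G₁ ∪ B.G₂ := fun e he h => by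
    rcases mem_union.1 h with h | h
    · exact Finset.disjoint_left.1 hG₁ h (hW.hN he)
    · exact Finset.disjoint_left.1 hG₂ h (hW.hN he)
  -- per-chord structure
  have unit : ∀ e ∈ B.N, ∃ j₁ j₂ : Fin m, ∃ σ τ : Fin n, j₁ ≠ j₂ ∧ B.D e = {j₁, j₂} ∧ Disjoint (andPair I j₁) (andPair I j₂) ∧
      σ ∈ andPair I j₁ ∧ τ ∈ andPair I j₂ ∧ (∀ v, Lit v ↔ (v = σ ∨ v = τ)) ∧
      ∃ g ∈ B.T₁ ∪ freeMon I B.N B.G₁ ∪ (B.T₂ ∪ freeMon I B.N B.G₂), σ ∈ andPair I g ∧ τ ∈ andPair I g := by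
    intro e he
    obtain ⟨a, b, β, α, m₁, m₂, hab, hq, hm₁, hm₂, hQ⟩ := hNOR e he
    obtain ⟨j₁, j₂, σ, τ, hne, hD, hdisj, hσ, hτ, hlit, hg⟩ :=
      nor_unit_of_dir I hI hS hB hW hr he (heG e he) mv hq hm₁ hm₂ hQ
    refine ⟨j₁, j₂, σ, τ, hne, hD, hdisj, hσ, hτ, fun v => ?_, hg⟩
    rw [← hlit v]
    exact (lit_iff_of_dir I B mv hab hq v).symm
  -- fix one chord and its literal pair
  obtain ⟨e₀, he₀⟩ := hN
  obtain ⟨i₁, i₂, σ, τ, hine, hD₀, hdisj₀, hσ₀, hτ₀, hlit₀, g₀, hg₀, hσg, hτg⟩ := unit e₀ he₀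
  have hστ : σ ≠ τ := fun h => Finset.disjoint_left.1 hdisj₀ hσ₀ (h ▸ hτ₀)
  -- every chord's pair is `{σ, τ}`; its fundamental set consists of two literal edges, none carrying both literals
  have chord : ∀ e ∈ B.N, ∃ j₁ j₂ : Fin m, j₁ ≠ j₂ ∧ B.D e = {j₁, j₂} ∧ LitEdge I σ τ j₁ ∧ LitEdge I σ τ j₂ ∧
      ¬ (σ ∈ andPair I j₁ ∧ τ ∈ andPair I j₁) ∧ ¬ (σ ∈ andPair I j₂ ∧ τ ∈ andPair I j₂) := by
    intro e he
    obtain ⟨j₁, j₂, σ', τ', hne, hD, hdisj, hσ', hτ', hlit', -⟩ := unit e he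
    -- `{σ', τ'} = {σ, τ}`
    have h1 : σ' = σ ∨ σ' = τ := (hlit₀ σ').1 ((hlit' σ').2 (Or.inl rfl))
    have h2 : τ' = σ ∨ τ' = τ := (hlit₀ τ').1 ((hlit' τ').2 (Or.inr rfl))
    have hσ'τ' : σ' ≠ τ' := fun h => Finset.disjoint_left.1 hdisj hσ' (h ▸ hτ')
    have litEdge_of : ∀ {j : Fin m} {ρ : Fin n}, ρ ∈ andPair I j → (ρ = σ ∨ ρ = τ) → LitEdge I σ τ j := by
      intro j ρ hρ hρ'
      unfold PstarLitNorCore.LitEdge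
      rcases (mem_andPair_iff I j ρ).1 hρ with h | h <;> rcases hρ' with rfl | rfl
      · exact Or.inl h.symm
      · exact Or.inr (Or.inl h.symm)
      · exact Or.inr (Or.inr (Or.inl h.symm))
      · exact Or.inr (Or.inr (Or.inr h.symm))
    have both : ∀ {j j' : Fin m} {ρ ρ' : Fin n}, Disjoint (andPair I j) (andPair I j') → ρ' ∈ andPair I j' →
        (ρ' = σ ∨ ρ' = τ) → ¬ (σ ∈ andPair I j ∧ τ ∈ andPair I j) := by
      intro j j' ρ ρ' hdj hρ' h' hboth
      -- `ρ' ∈ {σ, τ} ⊆ andPair j`, but `ρ' ∈ andPair j'`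
      have : ρ' ∈ andPair I j := by rcases h' with rfl | rfl; exacts [hboth.1, hboth.2]
      exact Finset.disjoint_left.1 hdj this hρ'
    exact ⟨j₁, j₂, hne, hD, litEdge_of hσ' h1, litEdge_of hτ' h2, both (ρ := σ') hdisj hτ' h2, both (ρ := τ') hdisj.symm hσ' h1⟩
  -- every fundamental-set member is a literal edge carrying not both literals
  have nonchord : ∀ e ∈ B.N, ∀ j ∈ B.D e, LitEdge I σ τ j ∧ ¬ (σ ∈ andPair I j ∧ τ ∈ andPair I j) := by
    intro e he j hje
    obtain ⟨j₁, j₂, -, hD, hL₁, hL₂, hb₁, hb₂⟩ := chord e he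
    rw [hD, mem_insert, mem_singleton] at hje
    rcases hje with rfl | rfl
    · exact ⟨hL₁, hb₁⟩
    · exact ⟨hL₂, hb₂⟩
  -- the gadget lies outside `J'`
  have hg₀J : g₀ ∉ J' := by
    intro hJ
    have hg₀N : g₀ ∉ B.N := fun h => by
      rcases mem_union.1 hg₀ with h' | h' <;> rcases mem_union.1 h' with h' | h'
      · exact (mem_sdiff.1 (hW.hT₁ h')).2 h
      · exact Finset.disjoint_left.1 hG₁ (mem_filter.1 h').1 (hW.hN h)
      · exact (mem_sdiff.1 (hW.hT₂ h')).2 h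
      · exact Finset.disjoint_left.1 hG₂ (mem_filter.1 h').1 (hW.hN h)
    rcases mem_union.1 hJ with h | h
    · exact hg₀N h
    · obtain ⟨e, he, hjD⟩ := mem_biUnion.1 h
      exact (nonchord e he g₀ hjD).2 ⟨hσg, hτg⟩
  have hg₀pair : (I.vars g₀ 2 = σ ∧ I.vars g₀ 3 = τ) ∨ (I.vars g₀ 2 = τ ∧ I.vars g₀ 3 = σ) := by
    rcases (mem_andPair_iff I g₀ σ).1 hσg with h | h <;> rcases (mem_andPair_iff I g₀ τ).1 hτg with h' | h'
    · exact absurd (h.trans h'.symm) hστ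
    · exact Or.inl ⟨h.symm, h'.symm⟩
    · exact Or.inr ⟨h'.symm, h.symm⟩
    · exact absurd (h.trans h'.symm) hστ
  -- the `LitNorStructure` on `J'`
  have hLNS : LitNorStructure I J' σ τ g₀ := by
    refine ⟨hστ, hg₀J, hg₀pair, fun j hj hnl => ?_⟩
    by_cases hjN : j ∈ B.N
    · refine ⟨isChord_of_subset I hJ'sub hj (hW.hchord j hjN), ?_⟩
      obtain ⟨j₁, j₂, hne, hD, hL₁, hL₂, -, -⟩ := chord j hjN
      have hjD : j ∉ ({j₁, j₂} : Finset (Fin m)) := fun h => (mem_sdiff.1 (hW.hD j hjN (hD ▸ h))).2 hjN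
      have heven : ∀ w, Even (xpdeg I (insert j {j₁, j₂}) w) := by rw [← hD]; exact hW.hDeven j hjN
      have hJ₁ : j₁ ∈ J' := hDJ' hjN (hD ▸ mem_insert_self _ _)
      have hJ₂ : j₂ ∈ J' := hDJ' hjN (hD ▸ mem_insert_of_mem (mem_singleton_self _))
      -- the ends of `j` lie on `j₁`, `j₂` (odd vertices of `D j`), one on each
      have hend : ∀ {s : Fin 4}, s.val < 2 → I.vars j s ∈ xpair I j₁ ∨ I.vars j s ∈ xpair I j₂ := by
        intro s hs
        obtain ⟨i, hi, hmem⟩ := exists_mem_of_odd I (odd_of_end I hI hjD heven hs)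
        rw [mem_insert, mem_singleton] at hi
        rcases hi with rfl | rfl
        · exact Or.inl hmem
        · exact Or.inr hmem
      have hj₁ne : j₁ ≠ j := fun h => hjD (h ▸ mem_insert_self _ _)
      have hj₂ne : j₂ ≠ j := fun h => hjD (h ▸ mem_insert_of_mem (mem_singleton_self _))
      rcases hend (s := 0) (by decide) with h0 | h0 <;> rcases hend (s := 1) (by decide) with h1 | h1
      · exact absurd (false_of_both_ends I hI hS hj₁ne h0 h1) id
      · exact litAdj_path I hI hS hne hjD heven hJ₁ hJ₂ hL₁ hL₂ h0 h1
      · have heven' : ∀ w, Even (xpdeg I (insert j {j₂, j₁}) w) := by rw [pair_comm]; exact heven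
        have hjD' : j ∉ ({j₂, j₁} : Finset (Fin m)) := by rw [pair_comm]; exact hjD
        exact litAdj_path I hI hS hne.symm hjD' heven' hJ₂ hJ₁ hL₂ hL₁ h0 h1
      · exact absurd (false_of_both_ends I hI hS hj₂ne h0 h1) id
    · rcases mem_union.1 hj with h | h
      · exact absurd h hjN
      · obtain ⟨e, he, hjD⟩ := mem_biUnion.1 h
        exact absurd (nonchord e he j hjD).1 hnl
  exact litNorCoreBound n m r I hI hB hS J' σ τ g₀ (lt_of_le_of_lt (card_le_card hJ'sub) hJr) (xorClosed_units I hI hW) hLNS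

/-- **All chords NOR-forced and the fundamental sets cover the non-chords ⟹ `#J₀ ≤ 5`.** -/
theorem card_le_five_of_all_nor_dir (I : LocalMap 4 n m) (hI : I.IsPure xorAndPred) (hS : SimpleOverlap I) {r : ℕ}
    (hB : BoundaryExpanding r I) {B : BridgeData n m} (hW : B.WF I) (hr : (B.J₀ ∪ B.G₁ ∪ B.G₂).card ≤ r) (hJr : B.J₀.card < r)
    (hG₁ : Disjoint B.G₁ B.J₀) (hG₂ : Disjoint B.G₂ B.J₀) (hN : B.N.Nonempty)
    (hcover : ∀ j ∈ B.J₀ \ B.N, ∃ e ∈ B.N, j ∈ B.D e) (mv : V2)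
    (hNOR : ∀ e ∈ B.N, ∃ a b : Fin n → ZMod 2, ∃ β α : ZMod 2, ∃ m₁ m₂ : (Fin n → ZMod 2) → ZMod 2,
      polarDir I B mv a b = 1 ∧
      (∀ x, qDir I B mv x = (polarDir I B mv x b + β) * (polarDir I B mv x a + α) + 1) ∧
      IsAffineFn m₁ ∧ IsAffineFn m₂ ∧
      ∀ x, qform (B.D e) (fun j => I.vars j 2) (fun j => I.vars j 3) x + (gam B e + 1) =
        (polarDir I B mv x b + β + 1) * m₁ x + (polarDir I B mv x a + α + 1) * m₂ x) :
    B.J₀.card ≤ 5 := by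
  classical
  refine le_trans (card_le_card fun j hj => ?_) (card_units_le_five_dir I hI hS hB hW hr hJr hG₁ hG₂ hN mv hNOR)
  by_cases hjN : j ∈ B.N
  · exact mem_union_left _ hjN
  · obtain ⟨e, he, hje⟩ := hcover j (mem_sdiff.2 ⟨hj, hjN⟩)
    exact mem_union_right _ (mem_biUnion.2 ⟨e, he, hje⟩)

/-- `card_units_le_five_dir` with the NOR data in the exact shape of the third disjunct of `PstarChordBridgeBasis.regime_cases`. -/
theorem card_units_le_five_of_regime (I : LocalMap 4 n m) (hI : I.IsPure xorAndPred) (hS : SimpleOverlap I) {r : ℕ}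
    (hB : BoundaryExpanding r I) {B : BridgeData n m} (hW : B.WF I) (hr : (B.J₀ ∪ B.G₁ ∪ B.G₂).card ≤ r) (hJr : B.J₀.card < r)
    (hG₁ : Disjoint B.G₁ B.J₀) (hG₂ : Disjoint B.G₂ B.J₀) (hN : B.N.Nonempty) (mv : V2)
    (hNOR : ∀ e ∈ B.N, ∃ a b : Fin n → ZMod 2, polarDir I B mv a b = 1 ∧
      (∀ x, qDir I B mv x =
        (polarDir I B mv x b + (qDir I B mv b + qDir I B mv 0)) * (polarDir I B mv x a + (qDir I B mv a + qDir I B mv 0)) + 1) ∧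
      ∃ m₁ m₂ : (Fin n → ZMod 2) → ZMod 2, IsAffineFn m₁ ∧ IsAffineFn m₂ ∧
        ∀ x, qform (B.D e) (fun j => I.vars j 2) (fun j => I.vars j 3) x + (gam B e + 1) =
          (polarDir I B mv x b + (qDir I B mv b + qDir I B mv 0) + 1) * m₁ x +
          (polarDir I B mv x a + (qDir I B mv a + qDir I B mv 0) + 1) * m₂ x) :
    (B.N ∪ B.N.biUnion B.D).card ≤ 5 :=
  card_units_le_five_dir I hI hS hB hW hr hJr hG₁ hG₂ hN mv fun e he => by
    obtain ⟨a, b, hab, hq, m₁, m₂, hm₁, hm₂, hQ⟩ := hNOR e he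
    exact ⟨a, b, _, _, m₁, m₂, hab, hq, hm₁, hm₂, hQ⟩

/-- **No (EQ) chord next to a NOR-type `q_m`.**  If `q_m` has the NOR form `(P x b + β)(P x a + α) + 1` then no chord `e ∈ N` satisfies
`Q_{D e} = q_m + κ`: the right-hand side is a product of affine functions plus a constant (rank `≤ 2`), while `Q_{D e}` has rank `≥ 4`
(`rank_four_of_wf`).  So once ONE chord is (NOR), every chord is (NOR) or (EXC). -/
theorem not_EQ_of_nor_dir (I : LocalMap 4 n m) (hI : I.IsPure xorAndPred) (hS : SimpleOverlap I) {r : ℕ} (hB : BoundaryExpanding r I)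
    {B : BridgeData n m} (hW : B.WF I) (hr : B.J₀.card ≤ r) (mv : V2) {a b : Fin n → ZMod 2} {β α : ZMod 2}
    (hq : ∀ x, qDir I B mv x = (polarDir I B mv x b + β) * (polarDir I B mv x a + α) + 1) {e : Fin m} (he : e ∈ B.N) {κ : ZMod 2}
    (hEQ : ∀ x, qform (B.D e) (fun j => I.vars j 2) (fun j => I.vars j 3) x = qDir I B mv x + κ) : False := by
  have haff : ∀ (y : Fin n → ZMod 2) (k : ZMod 2), IsAffineFn (fun x => polarDir I B mv x y + k) := by
    intro y k x w
    show polarDir I B mv (x + w) y + k = polarDir I B mv x y + k + (polarDir I B mv w y + k) + (polarDir I B mv 0 y + k)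
    rw [map_add, LinearMap.add_apply, map_zero, LinearMap.zero_apply, zero_add]
    generalize polarDir I B mv x y = s; generalize polarDir I B mv w y = t
    revert s t k; decide
  refine not_rank_four_of_mul (PstarChordBridgeForcing.qform_add' I (B.D e)) (haff b β) (haff a α) (κ := 1 + κ) (fun x => ?_)
    (rank_four_of_wf I hI hS hB hW hr he)
  rw [hEQ, hq]
  ring

end Summit.PneNP.PneNP.Theorems.PstarNorUnitDirAssembly
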